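import Literature.ModelTheory.Zilber.EACDensityLineTwist
import HarnessLib

/-!
# Totally real hyperplane × parametrised curve: the top-coefficient lemma

Zilber's Exponential-Algebraic Closedness, case ladder (host summit Schanuel, cell `pub-schanuel`,
seat 2, gen 7).  Helper for `ZilberEacRealParamCore`: if
`q₀' · ∏ⱼ qⱼ = q₀ · Σⱼ rⱼ qⱼ' ∏_{i≠j} qᵢ` in `ℂ[X]` then `deg q₀ = Σⱼ rⱼ deg qⱼ` (compare the coefficients
of `X^{deg q₀ + Σ deg qⱼ - 1}`).  This is what makes the holomorphic function
`log q₀(t) - Σ rⱼ log qⱼ(t) - c` of the engine non-constant when `deg q₀ ≠ Σ rⱼ deg qⱼ`.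
HONEST FRAMING: elementary algebra; nothing here bears on Schanuel's conjecture; `ECCell 3 2` OPEN.
-/

noncomputable section

open Complex

set_option linter.dupNamespace false

namespace Summit.Schanuel.Schanuel.Theorems

section ParamDegree

variable {s : ℕ}

/-- **Top coefficients, parametrised form.** If `q₀' · ∏ⱼ qⱼ = q₀ · Σⱼ rⱼ qⱼ' ∏_{i ≠ j} qᵢ` in `ℂ[X]`
(all `qⱼ ≠ 0`, `q₀ ≠ 0`) then `deg q₀ = Σⱼ rⱼ deg qⱼ`. -/
theorem natDegree_eq_of_deriv_prod_eq (r : Fin s → ℝ) {q : Fin s → Polynomial ℂ} (hq : ∀ j, q j ≠ 0)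
    {q₀ : Polynomial ℂ} (hq₀ : q₀ ≠ 0)
    (h : Polynomial.derivative q₀ * ∏ j, q j = q₀ * ∑ j, Polynomial.C (r j : ℂ) *
      (Polynomial.derivative (q j) * ∏ i ∈ Finset.univ.erase j, q i)) :
    (q₀.natDegree : ℝ) = ∑ j, r j * ((q j).natDegree : ℝ) := by
  classical
  set N : ℕ := ∑ j, (q j).natDegree with hN
  set Λ : ℂ := ∏ j, (q j).leadingCoeff with hΛ
  have hΛ0 : Λ ≠ 0 := Finset.prod_ne_zero_iff.2 fun j _ => Polynomial.leadingCoeff_ne_zero.2 (hq j)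
  have hlc0 : q₀.leadingCoeff ≠ 0 := Polynomial.leadingCoeff_ne_zero.2 hq₀
  have hPdeg : (∏ j, q j).natDegree = N := Polynomial.natDegree_prod _ _ fun j _ => hq j
  have hPlc : (∏ j, q j).coeff N = Λ := by
    rw [← hPdeg, Polynomial.coeff_natDegree, Polynomial.leadingCoeff_prod]
  -- `T := Σ rⱼ qⱼ' ∏_{i≠j} qᵢ` has degree `≤ N - 1` and coefficient `Σ rⱼ Dⱼ Λ` there
  set T : Polynomial ℂ := ∑ j, Polynomial.C (r j : ℂ) *
      (Polynomial.derivative (q j) * ∏ i ∈ Finset.univ.erase j, q i) with hT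
  have hTj : ∀ j, (Polynomial.derivative (q j) * ∏ i ∈ Finset.univ.erase j, q i).natDegree ≤ N - 1 := by
    intro j
    have herase : (∏ i ∈ Finset.univ.erase j, q i).natDegree =
        ∑ i ∈ Finset.univ.erase j, (q i).natDegree :=
      Polynomial.natDegree_prod _ _ fun i _ => hq i
    have hsumerase : (q j).natDegree + ∑ i ∈ Finset.univ.erase j, (q i).natDegree = N := by
      rw [hN, ← Finset.add_sum_erase _ _ (Finset.mem_univ j)]
    rcases Nat.eq_zero_or_pos (q j).natDegree with hD0 | hDpos
    · rw [Polynomial.derivative_of_natDegree_zero hD0, zero_mul, Polynomial.natDegree_zero]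
      exact Nat.zero_le _
    · refine (Polynomial.natDegree_mul_le).trans ?_
      have := Polynomial.natDegree_derivative_le (q j)
      rw [herase]
      omega
  have hTdeg : T.natDegree ≤ N - 1 := by
    refine Polynomial.natDegree_sum_le_of_forall_le _ _ fun j _ => ?_
    exact (Polynomial.natDegree_C_mul_le _ _).trans (hTj j)
  have hTcoeff : ∀ j, 1 ≤ N → (Polynomial.derivative (q j) * ∏ i ∈ Finset.univ.erase j, q i).coeff
      (N - 1) = ((q j).natDegree : ℂ) * Λ := by
    intro j hN1
    have herase : (∏ i ∈ Finset.univ.erase j, q i).natDegree =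
        ∑ i ∈ Finset.univ.erase j, (q i).natDegree :=
      Polynomial.natDegree_prod _ _ fun i _ => hq i
    have hsumerase : (q j).natDegree + ∑ i ∈ Finset.univ.erase j, (q i).natDegree = N := by
      rw [hN, ← Finset.add_sum_erase _ _ (Finset.mem_univ j)]
    have hΛj : (q j).leadingCoeff * (∏ i ∈ Finset.univ.erase j, q i).leadingCoeff = Λ := by
      rw [Polynomial.leadingCoeff_prod, hΛ, ← Finset.mul_prod_erase _ _ (Finset.mem_univ j)]
    rcases Nat.eq_zero_or_pos (q j).natDegree with hD0 | hDpos
    · rw [Polynomial.derivative_of_natDegree_zero hD0, zero_mul, Polynomial.coeff_zero, hD0,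
        Nat.cast_zero, zero_mul]
    · have hidx : N - 1 = ((q j).natDegree - 1) + ∑ i ∈ Finset.univ.erase j, (q i).natDegree := by
        omega
      have hn : (q j).natDegree - 1 + 1 = (q j).natDegree := Nat.sub_add_cancel hDpos
      have hc : (((q j).natDegree - 1 : ℕ) : ℂ) + 1 = ((q j).natDegree : ℂ) := by
        exact_mod_cast hn
      rw [hidx, Polynomial.coeff_mul_add_eq_of_natDegree_le (Polynomial.natDegree_derivative_le _)
        herase.le, Polynomial.coeff_derivative, hn, hc, ← herase,
        Polynomial.coeff_natDegree, Polynomial.coeff_natDegree, ← hΛj]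
      ring
  have hTtop : 1 ≤ N → T.coeff (N - 1) = (∑ j, (r j : ℂ) * ((q j).natDegree : ℂ)) * Λ := by
    intro hN1
    rw [hT, Polynomial.finsetSum_coeff]
    simp only [Polynomial.coeff_C_mul, fun j => hTcoeff j hN1, Finset.sum_mul]
    refine Finset.sum_congr rfl fun j _ => by ring
  rcases Nat.eq_zero_or_pos N with hN0 | hNpos
  · -- all `qⱼ` constant: then `q₀' · Λ = 0`, so `q₀' = 0`, `deg q₀ = 0 = Σ rⱼ · 0`
    have hDj : ∀ j, (q j).natDegree = 0 := fun j => by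
      have := Finset.single_le_sum (fun i _ => Nat.zero_le ((q i).natDegree)) (Finset.mem_univ j)
      omega
    have hT0 : T = 0 := by
      rw [hT]
      refine Finset.sum_eq_zero fun j _ => ?_
      rw [Polynomial.derivative_of_natDegree_zero (hDj j), zero_mul, mul_zero]
    rw [hT0, mul_zero] at h
    have hP0 : ∏ j, q j ≠ 0 := Finset.prod_ne_zero_iff.2 fun j _ => hq j
    have hq₀' : Polynomial.derivative q₀ = 0 := (mul_eq_zero.1 h).resolve_right hP0
    have hD₀ : q₀.natDegree = 0 := Polynomial.derivative_eq_zero.1 hq₀'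
    rw [hD₀]
    simp [hDj]
  · -- compare the coefficients of `X^{deg q₀ + N - 1}`
    have key : (q₀.natDegree : ℂ) * (q₀.leadingCoeff * Λ) =
        (∑ j, (r j : ℂ) * ((q j).natDegree : ℂ)) * (q₀.leadingCoeff * Λ) := by
      rcases Nat.eq_zero_or_pos q₀.natDegree with hD0 | hDpos
      · -- `q₀` constant: `q₀' = 0`, so `q₀ T = 0`, `T = 0`, and its top coefficient vanishes
        rw [Polynomial.derivative_of_natDegree_zero hD0, zero_mul] at h
        have hT0 : T = 0 := (mul_eq_zero.1 h.symm).resolve_left hq₀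
        have h2 := hTtop hNpos
        rw [hT0, Polynomial.coeff_zero] at h2
        rw [hD0, Nat.cast_zero, zero_mul, ← mul_assoc, mul_comm _ q₀.leadingCoeff, mul_assoc, ← h2,
          mul_zero]
      · have h1 : (Polynomial.derivative q₀ * ∏ j, q j).coeff ((q₀.natDegree - 1) + N) =
            (q₀ * T).coeff ((q₀.natDegree - 1) + N) := by rw [h]
        -- left side
        have hL : (Polynomial.derivative q₀ * ∏ j, q j).coeff ((q₀.natDegree - 1) + N) =
            (q₀.natDegree : ℂ) * (q₀.leadingCoeff * Λ) := by
          rw [Polynomial.coeff_mul_add_eq_of_natDegree_le (Polynomial.natDegree_derivative_le _)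
            hPdeg.le, hPlc]
          have hn : q₀.natDegree - 1 + 1 = q₀.natDegree := Nat.sub_add_cancel hDpos
          have hc : ((q₀.natDegree - 1 : ℕ) : ℂ) + 1 = (q₀.natDegree : ℂ) := by exact_mod_cast hn
          rw [Polynomial.coeff_derivative, hn, hc, Polynomial.coeff_natDegree]
          ring
        -- right side
        have hR : (q₀ * T).coeff ((q₀.natDegree - 1) + N) =
            (∑ j, (r j : ℂ) * ((q j).natDegree : ℂ)) * (q₀.leadingCoeff * Λ) := by
          have hidx : (q₀.natDegree - 1) + N = q₀.natDegree + (N - 1) := by omega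
          rw [hidx, Polynomial.coeff_mul_add_eq_of_natDegree_le le_rfl hTdeg,
            Polynomial.coeff_natDegree, hTtop hNpos]
          ring
        rw [hL, hR] at h1
        exact h1
    have hne : q₀.leadingCoeff * Λ ≠ 0 := mul_ne_zero hlc0 hΛ0
    have h2 := mul_right_cancel₀ hne key
    have h3 : ((q₀.natDegree : ℝ) : ℂ) = ((∑ j, r j * ((q j).natDegree : ℝ) : ℝ) : ℂ) := by
      push_cast
      exact h2
    exact_mod_cast h3

end ParamDegree

end Summit.Schanuel.Schanuel.Theorems

end
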